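import Summits.AtomisticToContinuum.Crystallization.Theorems.ChartedZeroExcessLayeredLatticeLiouvilleVG

/-!
# Zero-excess layered lattice Liouville — part VH (lens-2 g57, node «InPlaneRigid»): the IN-PLANE half of mode rigidity, for every affine field.

`ModeRigidAt` (part UQ) asks `‖M Y − M X‖² · #B ≤ C · dist(X, Y)² · idxEnergy M B` for truncated modes `M` and index balls `B` of radius `≥ n₁`.  For
`X, Y` on the SAME LAYER this holds for EVERY `IsAffine` field with the explicit constant `6` and `n₁ = 1`, with no harmonicity and no certificate:
`inPlane_rigid_of_isAffine`.  Mechanism: the in-plane increment is `Σ_j (Y − X)_j • g_j` (one common gradient), while the energy of `B` contains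
`#{X ∈ B : X + e_j ∈ B} · ‖g_j‖² ≥ (2/3) #B · ‖g_j‖²` from the `e_j`-bonds alone (`boxSum_le_sum` through the chart `cubePt` of part VE).  The CROSS-LAYER
half (layer increments of a mode comparable at all layers) is the 1D-chain content of brick (4) and is NOT touched here.
Bricks of (LD) `LinearExcessDecayZ` (conjunct `ModeRigidAt`); nothing of the column is re-typed, nothing here is an item.
-/

noncomputable section

open scoped BigOperators InnerProductSpace RealInnerProductSpace
open MeasureTheory Set Metric Filter Topology
open Summit.AtomisticToContinuum.Crystallization.Theorems.ChartedPlanarOrderRigidityDoor (E3 IsNash atomsIn)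
open Summit.AtomisticToContinuum.Crystallization.Theorems.ChartedPlanarOrderDensityDichotomy (μS IsSep nK nK_nonneg)
open Summit.AtomisticToContinuum.Crystallization.Theorems.ChartedPlanarOrderDoorLayered (Layered layeredHom_eq_layered)

namespace Summit.AtomisticToContinuum.Crystallization.Theorems.ChartedZeroExcessLayeredLatticeLiouville

section InPlaneRigid

/-! ### VH.1  In-plane increments of an affine field -/

/-- the in-plane increment of an affine field is the common gradient applied to the index difference. [formal bookkeeping] -/
theorem affine_sub_eq {M : Cell 2 → ℤ → E3} {g : Fin 2 → E3} {c : ℤ → E3} (hM : ∀ γ α, M γ α = (∑ j, ((γ j : ℤ) : ℝ) • g j) + c α)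
    {X Y : Cell 2 × ℤ} (hXY : X.2 = Y.2) : M Y.1 Y.2 - M X.1 X.2 = ∑ j, (((Y.1 j - X.1 j : ℤ)) : ℝ) • g j := by
  rw [hM, hM, hXY]
  simp only [Int.cast_sub, sub_smul, Finset.sum_sub_distrib]
  abel

/-- the unit in-plane steps of an affine field are the gradient vectors. [formal bookkeeping] -/
theorem affine_step₁ {M : Cell 2 → ℤ → E3} {g : Fin 2 → E3} {c : ℤ → E3} (hM : ∀ γ α, M γ α = (∑ j, ((γ j : ℤ) : ℝ) • g j) + c α)
    (X : Cell 2 × ℤ) : M (X + idxAxis₁).1 (X + idxAxis₁).2 - M X.1 X.2 = g 0 := by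
  rw [affine_sub_eq hM (by simp [idxAxis₁])]
  simp [Fin.sum_univ_two, idxAxis₁]

/-- Companion to `affine_step₁` for the second axis. [formal bookkeeping] -/
theorem affine_step₂ {M : Cell 2 → ℤ → E3} {g : Fin 2 → E3} {c : ℤ → E3} (hM : ∀ γ α, M γ α = (∑ j, ((γ j : ℤ) : ℝ) • g j) + c α)
    (X : Cell 2 × ℤ) : M (X + idxAxis₂).1 (X + idxAxis₂).2 - M X.1 X.2 = g 1 := by
  rw [affine_sub_eq hM (by simp [idxAxis₂])]
  simp [Fin.sum_univ_two, idxAxis₂]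

/-- the squared in-plane increment is at most `2 · dist² · (‖g₀‖² + ‖g₁‖²)`. [this file, g57] -/
theorem affine_sub_sq_le {M : Cell 2 → ℤ → E3} {g : Fin 2 → E3} {c : ℤ → E3} (hM : ∀ γ α, M γ α = (∑ j, ((γ j : ℤ) : ℝ) • g j) + c α)
    {X Y : Cell 2 × ℤ} (hXY : X.2 = Y.2) : ‖M Y.1 Y.2 - M X.1 X.2‖ ^ 2 ≤ 2 * dist X Y ^ 2 * (‖g 0‖ ^ 2 + ‖g 1‖ ^ 2) := by
  rw [affine_sub_eq hM hXY, Fin.sum_univ_two]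
  have hd : ∀ j : Fin 2, |(((Y.1 j - X.1 j : ℤ)) : ℝ)| ≤ dist X Y := fun j => by
    rw [dist_eq_idxNorm, ← Int.cast_abs, ← Nat.cast_natAbs]
    have := natAbs_fst_le_idxNorm (Y - X) j
    exact_mod_cast this
  have h0 : ‖(((Y.1 0 - X.1 0 : ℤ)) : ℝ) • g 0‖ ≤ dist X Y * ‖g 0‖ := by
    rw [norm_smul, Real.norm_eq_abs]
    exact mul_le_mul_of_nonneg_right (hd 0) (norm_nonneg _)
  have h1 : ‖(((Y.1 1 - X.1 1 : ℤ)) : ℝ) • g 1‖ ≤ dist X Y * ‖g 1‖ := by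
    rw [norm_smul, Real.norm_eq_abs]
    exact mul_le_mul_of_nonneg_right (hd 1) (norm_nonneg _)
  have hsum := (norm_add_le _ _).trans (add_le_add h0 h1)
  have hnn : 0 ≤ dist X Y * ‖g 0‖ + dist X Y * ‖g 1‖ := by positivity
  calc ‖(((Y.1 0 - X.1 0 : ℤ)) : ℝ) • g 0 + (((Y.1 1 - X.1 1 : ℤ)) : ℝ) • g 1‖ ^ 2
      ≤ (dist X Y * ‖g 0‖ + dist X Y * ‖g 1‖) ^ 2 := pow_le_pow_left₀ (norm_nonneg _) hsum 2
    _ ≤ 2 * dist X Y ^ 2 * (‖g 0‖ ^ 2 + ‖g 1‖ ^ 2) := by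
        nlinarith [sq_nonneg (dist X Y * ‖g 0‖ - dist X Y * ‖g 1‖)]

/-! ### VH.2  The energy of an index ball sees each in-plane gradient vector on two thirds of its sites -/

/-- the `e₁`-bond count: `(2R)(2R+1)² · ‖g₀‖² ≤ idxEnergy M B` (`R = ⌊n⌋₊`). [this file, g57] -/
theorem box_mul_sq_le_idxEnergy₁ {M : Cell 2 → ℤ → E3} {g : Fin 2 → E3} {c : ℤ → E3} (hM : ∀ γ α, M γ α = (∑ j, ((γ j : ℤ) : ℝ) • g j) + c α)
    (x₀ : Cell 2 × ℤ) {n : ℝ} (hn : 0 ≤ n) :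
    ((2 * ⌊n⌋₊ : ℕ) : ℝ) * (((2 * ⌊n⌋₊ : ℕ) : ℝ) + 1) ^ 2 * ‖g 0‖ ^ 2 ≤ idxEnergy M (idxBall x₀ n) := by
  set G : Cell 2 × ℤ → ℝ := fun Y => if Y + idxAxis₁ ∈ idxBallF x₀ n then dispSqFam M idxAxis₁ Y else 0 with hG
  have hG0 : ∀ Y, 0 ≤ G Y := fun Y => by
    simp only [hG]
    split_ifs
    · exact dispSqFam_nonneg M idxAxis₁ Y
    · exact le_rfl
  have hbox := boxSum_le_sum x₀ hn G hG0 (a := Finset.range (2 * ⌊n⌋₊)) (b := Finset.range (2 * ⌊n⌋₊ + 1)) (c := Finset.range (2 * ⌊n⌋₊ + 1))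
    (Finset.range_mono (Nat.le_succ _)) subset_rfl subset_rfl
  have hval : ∀ j ∈ Finset.range (2 * ⌊n⌋₊ + 1), ∀ i ∈ Finset.range (2 * ⌊n⌋₊), ∀ k ∈ Finset.range (2 * ⌊n⌋₊ + 1),
      G (cubePt x₀ ⌊n⌋₊ i j k) = ‖g 0‖ ^ 2 := by
    intro j hj i hi k hk
    rw [Finset.mem_range] at hi hj hk
    have hmem : cubePt x₀ ⌊n⌋₊ i j k + idxAxis₁ ∈ idxBallF x₀ n := by
      rw [← cubePt_succ₁]
      exact cubePt_mem x₀ hn (by omega) (by omega) (by omega)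
    simp only [hG, if_pos hmem, dispSqFam]
    rw [affine_step₁ hM]
  have hsumval : ∑ j ∈ Finset.range (2 * ⌊n⌋₊ + 1), ∑ i ∈ Finset.range (2 * ⌊n⌋₊), ∑ k ∈ Finset.range (2 * ⌊n⌋₊ + 1), G (cubePt x₀ ⌊n⌋₊ i j k) =
      ((2 * ⌊n⌋₊ : ℕ) : ℝ) * (((2 * ⌊n⌋₊ : ℕ) : ℝ) + 1) ^ 2 * ‖g 0‖ ^ 2 := by
    rw [Finset.sum_congr rfl fun j hj => Finset.sum_congr rfl fun i hi => Finset.sum_congr rfl fun k hk => hval j hj i hi k hk]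
    simp only [Finset.sum_const, Finset.card_range]
    push_cast
    ring
  have hdisp : ∑ Y ∈ idxBallF x₀ n, G Y = dispSqOn (idxBallF x₀ n) M idxAxis₁ := rfl
  rw [← hsumval, ← coe_idxBallF]
  exact hbox.trans (hdisp ▸ dispSqOn_le_idxEnergy (idxBallF x₀ n) M dist_add_idxAxis₁_le)

/-- Companion to `box_mul_sq_le_idxEnergy₁` for the second axis. [this file, g57] -/
theorem box_mul_sq_le_idxEnergy₂ {M : Cell 2 → ℤ → E3} {g : Fin 2 → E3} {c : ℤ → E3} (hM : ∀ γ α, M γ α = (∑ j, ((γ j : ℤ) : ℝ) • g j) + c α)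
    (x₀ : Cell 2 × ℤ) {n : ℝ} (hn : 0 ≤ n) :
    ((2 * ⌊n⌋₊ : ℕ) : ℝ) * (((2 * ⌊n⌋₊ : ℕ) : ℝ) + 1) ^ 2 * ‖g 1‖ ^ 2 ≤ idxEnergy M (idxBall x₀ n) := by
  set G : Cell 2 × ℤ → ℝ := fun Y => if Y + idxAxis₂ ∈ idxBallF x₀ n then dispSqFam M idxAxis₂ Y else 0 with hG
  have hG0 : ∀ Y, 0 ≤ G Y := fun Y => by
    simp only [hG]
    split_ifs
    · exact dispSqFam_nonneg M idxAxis₂ Y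
    · exact le_rfl
  have hbox := boxSum_le_sum x₀ hn G hG0 (a := Finset.range (2 * ⌊n⌋₊ + 1)) (b := Finset.range (2 * ⌊n⌋₊)) (c := Finset.range (2 * ⌊n⌋₊ + 1))
    subset_rfl (Finset.range_mono (Nat.le_succ _)) subset_rfl
  have hval : ∀ j ∈ Finset.range (2 * ⌊n⌋₊), ∀ i ∈ Finset.range (2 * ⌊n⌋₊ + 1), ∀ k ∈ Finset.range (2 * ⌊n⌋₊ + 1),
      G (cubePt x₀ ⌊n⌋₊ i j k) = ‖g 1‖ ^ 2 := by
    intro j hj i hi k hk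
    rw [Finset.mem_range] at hi hj hk
    have hmem : cubePt x₀ ⌊n⌋₊ i j k + idxAxis₂ ∈ idxBallF x₀ n := by
      rw [← cubePt_succ₂]
      exact cubePt_mem x₀ hn (by omega) (by omega) (by omega)
    simp only [hG, if_pos hmem, dispSqFam]
    rw [affine_step₂ hM]
  have hsumval : ∑ j ∈ Finset.range (2 * ⌊n⌋₊), ∑ i ∈ Finset.range (2 * ⌊n⌋₊ + 1), ∑ k ∈ Finset.range (2 * ⌊n⌋₊ + 1), G (cubePt x₀ ⌊n⌋₊ i j k) =
      ((2 * ⌊n⌋₊ : ℕ) : ℝ) * (((2 * ⌊n⌋₊ : ℕ) : ℝ) + 1) ^ 2 * ‖g 1‖ ^ 2 := by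
    rw [Finset.sum_congr rfl fun j hj => Finset.sum_congr rfl fun i hi => Finset.sum_congr rfl fun k hk => hval j hj i hi k hk]
    simp only [Finset.sum_const, Finset.card_range]
    push_cast
    ring
  have hdisp : ∑ Y ∈ idxBallF x₀ n, G Y = dispSqOn (idxBallF x₀ n) M idxAxis₂ := rfl
  rw [← hsumval, ← coe_idxBallF]
  exact hbox.trans (hdisp ▸ dispSqOn_le_idxEnergy (idxBallF x₀ n) M dist_add_idxAxis₂_le)

/-- site count versus bond count: `#B = (2R+1)³ ≤ (3/2)(2R)(2R+1)²` for `R ≥ 1`. [formal bookkeeping] -/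
theorem ncard_idxBall_le_box (x₀ : Cell 2 × ℤ) {n : ℝ} (hn : 1 ≤ n) :
    ((idxBall x₀ n).ncard : ℝ) ≤ 3 / 2 * (((2 * ⌊n⌋₊ : ℕ) : ℝ) * (((2 * ⌊n⌋₊ : ℕ) : ℝ) + 1) ^ 2) := by
  have hn0 : 0 ≤ n := zero_le_one.trans hn
  rw [← coe_idxBallF, Set.ncard_coe_finset, card_idxBallF_eq x₀ hn0]
  have hR : (1 : ℝ) ≤ ⌊n⌋₊ := by exact_mod_cast Nat.one_le_iff_ne_zero.mpr (Nat.pos_iff_ne_zero.mp (Nat.floor_pos.mpr hn))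
  push_cast
  nlinarith [sq_nonneg ((2 : ℝ) * ⌊n⌋₊ + 1)]

/-! ### VH.3  ★ In-plane rigidity of affine fields -/

/-- ★ **IN-PLANE MODE RIGIDITY** for every affine field and every index ball of radius `≥ 1`: for `X, Y` on the same layer,
`‖M Y − M X‖² · #idxBall x₀ n ≤ 6 · dist(X, Y)² · idxEnergy M (idxBall x₀ n)` — the `ModeRigidAt` inequality with `C = 6`, `n₁ = 1`, restricted to in-plane
pairs; `X, Y` need not lie in the ball.  No harmonicity, no certificate. [this file, g57] -/
theorem inPlane_rigid_of_isAffine {M : Cell 2 → ℤ → E3} (hM : IsAffine M) (x₀ : Cell 2 × ℤ) {n : ℝ} (hn : 1 ≤ n) {X Y : Cell 2 × ℤ} (hXY : X.2 = Y.2) :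
    ‖M Y.1 Y.2 - M X.1 X.2‖ ^ 2 * ((idxBall x₀ n).ncard : ℝ) ≤ 6 * dist X Y ^ 2 * idxEnergy M (idxBall x₀ n) := by
  obtain ⟨g, c, hgc⟩ := hM
  have hn0 : 0 ≤ n := zero_le_one.trans hn
  have h1 := box_mul_sq_le_idxEnergy₁ hgc x₀ hn0
  have h2 := box_mul_sq_le_idxEnergy₂ hgc x₀ hn0
  have hsq := affine_sub_sq_le hgc hXY
  have hcard := ncard_idxBall_le_box x₀ hn
  have hN : 0 ≤ ((idxBall x₀ n).ncard : ℝ) := Nat.cast_nonneg _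
  have hP : 0 ≤ ((2 * ⌊n⌋₊ : ℕ) : ℝ) * (((2 * ⌊n⌋₊ : ℕ) : ℝ) + 1) ^ 2 := by positivity
  have hd : 0 ≤ dist X Y ^ 2 := sq_nonneg _
  calc ‖M Y.1 Y.2 - M X.1 X.2‖ ^ 2 * ((idxBall x₀ n).ncard : ℝ)
      ≤ (2 * dist X Y ^ 2 * (‖g 0‖ ^ 2 + ‖g 1‖ ^ 2)) * (3 / 2 * (((2 * ⌊n⌋₊ : ℕ) : ℝ) * (((2 * ⌊n⌋₊ : ℕ) : ℝ) + 1) ^ 2)) :=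
        mul_le_mul hsq hcard hN (by positivity)
    _ = 3 * dist X Y ^ 2 * ((((2 * ⌊n⌋₊ : ℕ) : ℝ) * (((2 * ⌊n⌋₊ : ℕ) : ℝ) + 1) ^ 2 * ‖g 0‖ ^ 2) +
          (((2 * ⌊n⌋₊ : ℕ) : ℝ) * (((2 * ⌊n⌋₊ : ℕ) : ℝ) + 1) ^ 2 * ‖g 1‖ ^ 2)) := by ring
    _ ≤ 3 * dist X Y ^ 2 * (idxEnergy M (idxBall x₀ n) + idxEnergy M (idxBall x₀ n)) := by gcongr
    _ = 6 * dist X Y ^ 2 * idxEnergy M (idxBall x₀ n) := by ring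

/-- the same for truncated modes (the in-plane half of `ModeRigidAt 6 ϱ 1`). [formal bookkeeping] -/
theorem inPlane_rigid_of_isTruncMode {ϱ : ℝ} {a b : E3} {w : ℤ → E3} {M : Cell 2 → ℤ → E3} (hM : IsTruncMode ϱ a b w M) (x₀ : Cell 2 × ℤ)
    {n : ℝ} (hn : 1 ≤ n) {X Y : Cell 2 × ℤ} (hXY : X.2 = Y.2) :
    ‖M Y.1 Y.2 - M X.1 X.2‖ ^ 2 * ((idxBall x₀ n).ncard : ℝ) ≤ 6 * dist X Y ^ 2 * idxEnergy M (idxBall x₀ n) :=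
  inPlane_rigid_of_isAffine hM.1 x₀ hn hXY

/-! ### VH.4  The type `IsTruncMode` carries a free layer profile (critic row 915 (b2)) -/

/-- the increment of an affine field across layers: common gradient part plus the PROFILE increment. [formal bookkeeping] -/
theorem affine_sub_eq' {M : Cell 2 → ℤ → E3} {g : Fin 2 → E3} {c : ℤ → E3} (hM : ∀ γ α, M γ α = (∑ j, ((γ j : ℤ) : ℝ) • g j) + c α)
    (X Y : Cell 2 × ℤ) : M Y.1 Y.2 - M X.1 X.2 = (∑ j, (((Y.1 j - X.1 j : ℤ)) : ℝ) • g j) + (c Y.2 - c X.2) := by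
  rw [hM, hM]
  simp only [Int.cast_sub, sub_smul, Finset.sum_sub_distrib]
  abel

/-- ★ (row 915 (b2)) `IsTruncMode` contains, for EVERY in-plane gradient `g` and EVERY Lipschitz layer profile `c`, the field `(γ, α) ↦ Σ_j γ_j • g_j + c α`
as soon as it is truncated-harmonic everywhere: the type ties the profile to the gradient ONLY through harmonicity (the 1D chain equation with the
mode's flux) — the conormal freedom of laminates (`∂₃u` jumps layer to layer) is inside the mode family, as `ModalLipschitzAt` requires. [this file, g57] -/
theorem isTruncMode_of_profile {ϱ : ℝ} {a b : E3} {w : ℤ → E3} (g : Fin 2 → E3) (c : ℤ → E3) {m : ℝ}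
    (hc : ∀ α β : ℤ, ‖c β - c α‖ ≤ m * |(((β - α : ℤ)) : ℝ)|)
    (hH : IsTruncHarmonicZ ϱ a b w (fun γ α => (∑ j, ((γ j : ℤ) : ℝ) • g j) + c α) Set.univ) :
    IsTruncMode ϱ a b w (fun γ α => (∑ j, ((γ j : ℤ) : ℝ) • g j) + c α) := by
  refine ⟨⟨g, c, fun γ α => rfl⟩, ⟨‖g 0‖ + ‖g 1‖ + max m 0, fun X Y => ?_⟩, hH⟩
  have hMform : ∀ (γ : Cell 2) (α : ℤ), (fun (γ' : Cell 2) (α' : ℤ) => (∑ j, ((γ' j : ℤ) : ℝ) • g j) + c α') γ α = (∑ j, ((γ j : ℤ) : ℝ) • g j) + c α :=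
    fun _ _ => rfl
  rw [affine_sub_eq' hMform X Y, Fin.sum_univ_two]
  have hd : ∀ j : Fin 2, |(((Y.1 j - X.1 j : ℤ)) : ℝ)| ≤ dist X Y := fun j => by
    rw [dist_eq_idxNorm, ← Int.cast_abs, ← Nat.cast_natAbs]
    have := natAbs_fst_le_idxNorm (Y - X) j
    exact_mod_cast this
  have hd2 : |(((Y.2 - X.2 : ℤ)) : ℝ)| ≤ dist X Y := by
    rw [dist_eq_idxNorm, ← Int.cast_abs, ← Nat.cast_natAbs]
    have := natAbs_snd_le_idxNorm (Y - X)
    exact_mod_cast this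
  have h0 : ‖(((Y.1 0 - X.1 0 : ℤ)) : ℝ) • g 0‖ ≤ dist X Y * ‖g 0‖ := by
    rw [norm_smul, Real.norm_eq_abs]
    exact mul_le_mul_of_nonneg_right (hd 0) (norm_nonneg _)
  have h1 : ‖(((Y.1 1 - X.1 1 : ℤ)) : ℝ) • g 1‖ ≤ dist X Y * ‖g 1‖ := by
    rw [norm_smul, Real.norm_eq_abs]
    exact mul_le_mul_of_nonneg_right (hd 1) (norm_nonneg _)
  have h2 : ‖c Y.2 - c X.2‖ ≤ dist X Y * max m 0 := by
    refine (hc X.2 Y.2).trans ?_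
    rw [mul_comm (dist X Y)]
    exact (mul_le_mul_of_nonneg_right (le_max_left m 0) (abs_nonneg _)).trans (mul_le_mul_of_nonneg_left hd2 (le_max_right m 0))
  calc ‖(((Y.1 0 - X.1 0 : ℤ)) : ℝ) • g 0 + (((Y.1 1 - X.1 1 : ℤ)) : ℝ) • g 1 + (c Y.2 - c X.2)‖
      ≤ ‖(((Y.1 0 - X.1 0 : ℤ)) : ℝ) • g 0‖ + ‖(((Y.1 1 - X.1 1 : ℤ)) : ℝ) • g 1‖ + ‖c Y.2 - c X.2‖ := norm_add₃_le
    _ ≤ dist X Y * ‖g 0‖ + dist X Y * ‖g 1‖ + dist X Y * max m 0 := add_le_add (add_le_add h0 h1) h2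
    _ = (‖g 0‖ + ‖g 1‖ + max m 0) * dist X Y := by ring

end InPlaneRigid

end Summit.AtomisticToContinuum.Crystallization.Theorems.ChartedZeroExcessLayeredLatticeLiouville
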